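import Mathlib

/-!
# PercRepro — THE `5/2` TAIL: `16·Σ_{j ≤ K} C(n, j) ≤ 2^n` for every `n` with `5K + 14 ≤ 2n` (p4, gen 15; a feeder for S4)

Sharpens `ThmN.Explicit.sixteen_mul_sum_range_choose_le` (`3K + 5 ≤ n`, p9) to the slope `5/2`: below `K` the ratio
`C(n, j)/C(n, j + 1) = (j + 1)/(n − j)` is at most `2/3` once `5K ≤ 2n + 2`, so `Σ_{j ≤ K} C(n, j) ≤ 3·C(n, K)`
(`sum_range_choose_le_three_mul_choose`); and `48·C(n, K) ≤ 2^n` from `5K + 14 ≤ 2n` (`choose_mul_fortyeight_le_two_pow`):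
along the base line `a = n − K = (3K + 15)/2` by an induction on `K` in steps of two — the ratio
`C(N + 5, K + 2)/C(N, K) = (N+5)(N+4)(N+3)(N+2)(N+1)/((K+2)(K+1)(a+3)(a+2)(a+1))` is at most `32` there, a polynomial
inequality whose difference has nonnegative coefficients (`ratio_step_even` / `ratio_step_odd`) — and above the base line
by the doubling `C(n + 1, K) ≤ 2·C(n, K)` (`n ≥ 2K`). Used for the `Y`-side tails of the level-`q` chains at
`n ≥ P + d` with `P` well below `3d + 5`.
Axioms: standard.
-/

namespace PercRepro

namespace ThmN.Explicit

/-- `3·C(n, k) ≤ 2·C(n, k + 1)` when `5k + 3 ≤ 2n` (the ratio `(k + 1)/(n − k)` is at most `2/3`). -/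
theorem three_mul_choose_le_two_mul_choose_succ (n k : ℕ) (h : 5 * k + 3 ≤ 2 * n) :
    3 * n.choose k ≤ 2 * n.choose (k + 1) := by
  have e := Nat.choose_succ_right_eq n k
  have hpos : 0 < k + 1 := by omega
  have hle : 3 * (k + 1) ≤ 2 * (n - k) := by omega
  have key : 3 * n.choose k * (k + 1) ≤ 2 * n.choose (k + 1) * (k + 1) := by
    calc 3 * n.choose k * (k + 1) = n.choose k * (3 * (k + 1)) := by ring
      _ ≤ n.choose k * (2 * (n - k)) := Nat.mul_le_mul_left _ hle
      _ = 2 * (n.choose k * (n - k)) := by ring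
      _ = 2 * (n.choose (k + 1) * (k + 1)) := by rw [e]
      _ = 2 * n.choose (k + 1) * (k + 1) := by ring
  exact Nat.le_of_mul_le_mul_right key hpos

/-- `Σ_{j ≤ K} C(n, j) ≤ 3·C(n, K)` for `5K ≤ 2n + 2` (geometric decay with ratio `2/3` below `K`). -/
theorem sum_range_choose_le_three_mul_choose (n : ℕ) : ∀ K, 5 * K ≤ 2 * n + 2 →
    ∑ j ∈ Finset.range (K + 1), n.choose j ≤ 3 * n.choose K := by
  intro K
  induction K with
  | zero => intro _; simp
  | succ K ih =>
    intro hn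
    have h1 := ih (by omega)
    have h2 := three_mul_choose_le_two_mul_choose_succ n K (by omega)
    rw [Finset.sum_range_succ]
    omega

/-- The factorial identity of the two-step ratio: with `N = K + a`,
`C(N + 5, K + 2)·((K + 2)(K + 1)(a + 3)(a + 2)(a + 1)) = C(N, K)·((N + 5)(N + 4)(N + 3)(N + 2)(N + 1))`. -/
theorem choose_add_five_mul_eq (K a : ℕ) :
    (K + a + 5).choose (K + 2) * ((K + 2) * (K + 1) * ((a + 3) * (a + 2) * (a + 1))) =
      (K + a).choose K * ((K + a + 5) * (K + a + 4) * (K + a + 3) * (K + a + 2) * (K + a + 1)) := by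
  have h1 := Nat.choose_mul_factorial_mul_factorial (show K ≤ K + a by omega)
  have h2 := Nat.choose_mul_factorial_mul_factorial (show K + 2 ≤ K + a + 5 by omega)
  rw [show K + a + 5 - (K + 2) = a + 3 by omega] at h2
  rw [show K + a - K = a by omega] at h1
  have e1 : (K + 2).factorial = (K + 2) * (K + 1) * K.factorial := by
    rw [Nat.factorial_succ, Nat.factorial_succ]; ring
  have e2 : (a + 3).factorial = (a + 3) * (a + 2) * (a + 1) * a.factorial := by
    rw [Nat.factorial_succ, Nat.factorial_succ, Nat.factorial_succ]; ring
  have e3 : (K + a + 5).factorial =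
      (K + a + 5) * (K + a + 4) * (K + a + 3) * (K + a + 2) * (K + a + 1) * (K + a).factorial := by
    rw [show K + a + 5 = K + a + 4 + 1 by ring, Nat.factorial_succ,
      show K + a + 4 = K + a + 3 + 1 by ring, Nat.factorial_succ,
      show K + a + 3 = K + a + 2 + 1 by ring, Nat.factorial_succ,
      show K + a + 2 = K + a + 1 + 1 by ring, Nat.factorial_succ, Nat.factorial_succ]
    ring
  apply Nat.eq_of_mul_eq_mul_right (Nat.mul_pos (Nat.factorial_pos K) (Nat.factorial_pos a))
  calc (K + a + 5).choose (K + 2) * ((K + 2) * (K + 1) * ((a + 3) * (a + 2) * (a + 1))) *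
        (K.factorial * a.factorial)
      = (K + a + 5).choose (K + 2) * (K + 2).factorial * (a + 3).factorial := by rw [e1, e2]; ring
    _ = (K + a + 5).factorial := h2
    _ = (K + a + 5) * (K + a + 4) * (K + a + 3) * (K + a + 2) * (K + a + 1) * (K + a).factorial := e3
    _ = (K + a + 5) * (K + a + 4) * (K + a + 3) * (K + a + 2) * (K + a + 1) *
        ((K + a).choose K * K.factorial * a.factorial) := by rw [h1]
    _ = (K + a).choose K * ((K + a + 5) * (K + a + 4) * (K + a + 3) * (K + a + 2) * (K + a + 1)) *
        (K.factorial * a.factorial) := by ring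

/-- The ratio step on the even chain (`K = 2u + 4`, `a = 3u + 13`, `N = 5u + 17`):
`(N+5)(N+4)(N+3)(N+2)(N+1) ≤ 32·(K+2)(K+1)(a+3)(a+2)(a+1)`. -/
theorem ratio_step_even (u : ℕ) :
    (5 * u + 22) * (5 * u + 21) * (5 * u + 20) * (5 * u + 19) * (5 * u + 18) ≤
      32 * ((2 * u + 6) * (2 * u + 5) * ((3 * u + 16) * (3 * u + 15) * (3 * u + 14))) := by
  have h : 32 * ((2 * u + 6) * (2 * u + 5) * ((3 * u + 16) * (3 * u + 15) * (3 * u + 14))) =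
      (5 * u + 22) * (5 * u + 21) * (5 * u + 20) * (5 * u + 19) * (5 * u + 18) +
        (65520 + 336540 * u + 249868 * u ^ 2 + 70481 * u ^ 3 + 8348 * u ^ 4 + 331 * u ^ 5) := by ring
  rw [h]
  exact Nat.le_add_right _ _

/-- The ratio step on the odd chain (`K = 2u + 5`, `a = 3u + 15`, `N = 5u + 20`). -/
theorem ratio_step_odd (u : ℕ) :
    (5 * u + 25) * (5 * u + 24) * (5 * u + 23) * (5 * u + 22) * (5 * u + 21) ≤
      32 * ((2 * u + 7) * (2 * u + 6) * ((3 * u + 18) * (3 * u + 17) * (3 * u + 16))) := by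
  have h : 32 * ((2 * u + 7) * (2 * u + 6) * ((3 * u + 18) * (3 * u + 17) * (3 * u + 16))) =
      (5 * u + 25) * (5 * u + 24) * (5 * u + 23) * (5 * u + 22) * (5 * u + 21) +
        (204624 + 608814 * u + 371995 * u ^ 2 + 90095 * u ^ 3 + 9341 * u ^ 4 + 331 * u ^ 5) := by ring
  rw [h]
  exact Nat.le_add_right _ _

/-- One two-step along the base line: from `48·C(N, K) ≤ 2^N` to `48·C(N + 5, K + 2) ≤ 2^(N + 5)`, given the
polynomial ratio bound `P ≤ 32·D`. -/
theorem step_of_ratio (K a : ℕ)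
    (hP : (K + a + 5) * (K + a + 4) * (K + a + 3) * (K + a + 2) * (K + a + 1) ≤
      32 * ((K + 2) * (K + 1) * ((a + 3) * (a + 2) * (a + 1))))
    (ih : 48 * (K + a).choose K ≤ 2 ^ (K + a)) :
    48 * (K + a + 5).choose (K + 2) ≤ 2 ^ (K + a + 5) := by
  have hD : 0 < (K + 2) * (K + 1) * ((a + 3) * (a + 2) * (a + 1)) := by positivity
  apply Nat.le_of_mul_le_mul_right _ hD
  calc 48 * (K + a + 5).choose (K + 2) * ((K + 2) * (K + 1) * ((a + 3) * (a + 2) * (a + 1)))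
      = 48 * ((K + a + 5).choose (K + 2) * ((K + 2) * (K + 1) * ((a + 3) * (a + 2) * (a + 1)))) := by ring
    _ = 48 * ((K + a).choose K * ((K + a + 5) * (K + a + 4) * (K + a + 3) * (K + a + 2) * (K + a + 1))) := by
        rw [choose_add_five_mul_eq]
    _ ≤ 48 * ((K + a).choose K * (32 * ((K + 2) * (K + 1) * ((a + 3) * (a + 2) * (a + 1))))) := by
        gcongr
    _ = (48 * (K + a).choose K) * 32 * ((K + 2) * (K + 1) * ((a + 3) * (a + 2) * (a + 1))) := by ring
    _ ≤ 2 ^ (K + a) * 32 * ((K + 2) * (K + 1) * ((a + 3) * (a + 2) * (a + 1))) := by gcongr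
    _ = 2 ^ (K + a + 5) * ((K + 2) * (K + 1) * ((a + 3) * (a + 2) * (a + 1))) := by ring

/-- The base line: `48·C(K + a, K) ≤ 2^(K + a)` at `a = (3K + 15)/2`, for every `K`. -/
theorem fortyeight_mul_choose_base (K : ℕ) :
    48 * (K + (3 * K + 15) / 2).choose K ≤ 2 ^ (K + (3 * K + 15) / 2) := by
  induction K using Nat.strong_induction_on with
  | _ K ih =>
  rcases lt_or_ge K 6 with hK | hK
  · interval_cases K <;> decide
  · obtain ⟨K', rfl⟩ : ∃ K', K = K' + 2 := ⟨K - 2, by omega⟩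
    have ih' := ih K' (by omega)
    have ha : (3 * (K' + 2) + 15) / 2 = (3 * K' + 15) / 2 + 3 := by omega
    rw [ha, show K' + 2 + ((3 * K' + 15) / 2 + 3) = K' + (3 * K' + 15) / 2 + 5 by ring]
    apply step_of_ratio K' ((3 * K' + 15) / 2) _ ih'
    obtain ⟨m, hm | hm⟩ := Nat.even_or_odd' K'
    · -- even chain, `K' = 2m`, `m ≥ 2`
      obtain ⟨u, rfl⟩ : ∃ u, m = u + 2 := ⟨m - 2, by omega⟩
      subst hm
      have ha' : (3 * (2 * (u + 2)) + 15) / 2 = 3 * u + 13 := by omega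
      rw [ha']
      have := ratio_step_even u
      convert this using 1 <;> ring
    · -- odd chain, `K' = 2m + 1`, `m ≥ 2`
      obtain ⟨u, rfl⟩ : ∃ u, m = u + 2 := ⟨m - 2, by omega⟩
      subst hm
      have ha' : (3 * (2 * (u + 2) + 1) + 15) / 2 = 3 * u + 15 := by omega
      rw [ha']
      have := ratio_step_odd u
      convert this using 1 <;> ring

/-- **`48·C(n, K) ≤ 2^n` whenever `5K + 14 ≤ 2n`** (the base line, then the doubling `C(n + 1, K) ≤ 2·C(n, K)`). -/
theorem choose_mul_fortyeight_le_two_pow (K n : ℕ) (hn : 5 * K + 14 ≤ 2 * n) :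
    48 * n.choose K ≤ 2 ^ n := by
  have hn0 : K + (3 * K + 15) / 2 ≤ n := by omega
  clear hn
  induction n, hn0 using Nat.le_induction with
  | base => exact fortyeight_mul_choose_base K
  | succ n hn ih =>
    have hdouble : (n + 1).choose K ≤ 2 * n.choose K := by
      rcases K with _ | K
      · simp
      · rw [Nat.choose_succ_succ']
        have : n.choose K ≤ n.choose (K + 1) := Nat.choose_le_succ_of_lt_half_left (by omega)
        omega
    calc 48 * (n + 1).choose K ≤ 48 * (2 * n.choose K) := Nat.mul_le_mul_left _ hdouble
      _ = 2 * (48 * n.choose K) := by ring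
      _ ≤ 2 * 2 ^ n := Nat.mul_le_mul_left _ ih
      _ = 2 ^ (n + 1) := by ring

/-- **THE `5/2` TAIL**: `16·Σ_{j ≤ K} C(n, j) ≤ 2^n` for every `n` with `5K + 14 ≤ 2n`. -/
theorem sixteen_mul_sum_range_choose_le' (K n : ℕ) (hn : 5 * K + 14 ≤ 2 * n) :
    16 * ∑ j ∈ Finset.range (K + 1), n.choose j ≤ 2 ^ n := by
  have h1 := sum_range_choose_le_three_mul_choose n K (by omega)
  have h2 := choose_mul_fortyeight_le_two_pow K n hn
  omega

end ThmN.Explicit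

end PercRepro
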